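import Summits.BirchSwinnertonDyer.BirchSwinnertonDyer.Theorems.ResidualThetaTransportAtTwoThetaLayerLambdaCongruenceAtTwoCuspSpanSquarefreePotential
import Summits.BirchSwinnertonDyer.BirchSwinnertonDyer.Theorems.ResidualThetaTransportAtTwoThetaLayerLambdaCongruenceAtTwoCuspSpanB1GenTwoPrimes
import Summits.BirchSwinnertonDyer.BirchSwinnertonDyer.Theorems.ResidualThetaTransportAtTwoThetaLayerLambdaCongruenceAtTwoCuspSpanCharacterOdd
import HarnessLib

/-!
# Route `ResidualThetaTransportAtTwo`, cruxes Kan⁺ (stmt-BirchSwinnertonDyer-20688) / node 27436 / 21437: the node at a squarefree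
# THREE-PRIME level `N = pqr` REDUCES to «the potential vanishes at the cusps `1/w` of the three single-prime types»

Cell `bsd-wall`, lead prover `bsd-wall-rtt-p3` g10 (2026-08-28). THEOREMS ONLY (no `def`, no `sorry`);
`--supports stmt-BirchSwinnertonDyer-20688`; BSD is not proved by this. Sequel to `…CuspSpanSquarefreePotential`.

Let `p, q, r` be distinct odd primes, `N = pqr`, `χ : Γ₀(N) → 𝔽₂` additive killing the trace-`±2` elements and `B₁`, `φ` a potential
with `φ(0,1) = 0`, `φ(1,d) = 0` (`d ∣ N`).
* §1 MIXED ROWS AT THREE PRIMES (`phi_col_eq_threePrimes`): if `φ(1, ·) ≡ 0` then the symbol function vanishes on all of `SL₂(ℤ)`: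
  rows with `d` or `c` prime to `N` by the engine; a mixed row (`ℓ₁ ∣ d`, `ℓ₂ ∣ c`) has `c + d` prime to `N` unless the third prime
  divides `c + d`, and then `c − d` is prime to `N` (the third prime cannot divide `2c`), so the triangle applies to `g` or to `gσ`.
* §2 **`chi_eq_zero_threePrimes_of_singleTypes`** — (G‴)_N at `N = pqr` follows from the CERTIFICATE OBLIGATION «for every potential
  `φ` of `χ` normalised as above, `φ(1, w) = 0` whenever exactly one of `p, q, r` divides `w`»: the unit type is `B₁`, the type `N` is
  `L_w`, the two-prime types `pq, pr, qr` have prime colevel (`phi_one_eq_zero_of_dvd_of_coprime_prime`). With rtt-p3-w4 g2's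
  `cuspSpanEvenAtTwo_of_forall_b1_odd`: **`cuspSpanEvenAtTwo_threePrimes_of_singleTypes`** — the node at `pqr` from that obligation
  (to be discharged per level by the moves of `…CuspSpanPotentialMoves`, or uniformly — open, `Lines/birth-twoprimes.md` §3).

References: [Manin1972] §1.5–1.7; [Rademacher1929] §1; [Pollack2003] Conj. 6.3.
-/

set_option autoImplicit false
set_option linter.dupNamespace false

noncomputable section

open scoped MatrixGroups

open CongruenceSubgroup Literature.NumberTheory.EllipticCurves.ModularForms

namespace Summit.BirchSwinnertonDyer.BirchSwinnertonDyer.Theorems.SignedMuAtTwo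

namespace Potential

variable {N : ℕ} {χ : Gamma0 N → ZMod 2} {φ : ℤ → ℤ → ZMod 2}

/-! ## §1. The symbol function on the mixed rows at three primes -/

/-- The triangle at `g`: if `−c − d` is prime to `N` (and `φ(1,·) ≡ 0`, `φ(0,1) = 0`) then `φ(col₀ g) = φ(col₁ g)` (any level).
[cite: Manin1972, §1.7] -/
theorem phi_col_eq_of_isCoprime_sum
    (hsmall : ∀ γ : Gamma0 N, ((γ : SL(2, ℤ)) 0 0 + (γ : SL(2, ℤ)) 1 1).natAbs ≤ 2 → χ γ = 0)
    (hφ : ∀ (γ : Gamma0 N) (x y : ℤ), IsCoprime x y →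
      φ ((γ : SL(2, ℤ)) 0 0 * x + (γ : SL(2, ℤ)) 0 1 * y) ((γ : SL(2, ℤ)) 1 0 * x + (γ : SL(2, ℤ)) 1 1 * y) = χ γ + φ x y)
    (hone : ∀ w : ℤ, φ 1 w = 0) (h01 : φ 0 1 = 0) (g : SL(2, ℤ)) (hsum : IsCoprime (-(g 1 0) - g 1 1) (N : ℤ)) :
    φ (g 0 0) (g 1 0) = φ (g 0 1) (g 1 1) := by
  obtain ⟨g₁, a00, a01, a10, a11⟩ := exists_sl2_entries (g 0 1) (-(g 0 0) - g 0 1) (g 1 1) (-(g 1 0) - g 1 1)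
    (by linear_combination det_entries g)
  obtain ⟨g₂, b00, b01, b10, b11⟩ := exists_sl2_entries (-(g 0 0) - g 0 1) (g 0 0) (-(g 1 0) - g 1 1) (g 1 0)
    (by linear_combination det_entries g)
  have h₁ := phi_col_eq_of_isCoprime_right hφ hone h01 g₁ (by rw [a11]; exact hsum)
  have h₂ := phi_col_eq_of_isCoprime_left hsmall hφ hone h01 g₂ (by rw [b10]; exact hsum)
  rw [a00, a01, a10, a11] at h₁
  rw [b00, b01, b10, b11] at h₂
  rw [← h₂, ← h₁]

/-- The triangle at `gσ`: if `c − d` is prime to `N` then `φ(col₀ g) = φ(col₁ g)` (column swap, then the previous lemma). [cite: Manin1972, §1.7] -/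
theorem phi_col_eq_of_isCoprime_diff
    (hsmall : ∀ γ : Gamma0 N, ((γ : SL(2, ℤ)) 0 0 + (γ : SL(2, ℤ)) 1 1).natAbs ≤ 2 → χ γ = 0)
    (hφ : ∀ (γ : Gamma0 N) (x y : ℤ), IsCoprime x y →
      φ ((γ : SL(2, ℤ)) 0 0 * x + (γ : SL(2, ℤ)) 0 1 * y) ((γ : SL(2, ℤ)) 1 0 * x + (γ : SL(2, ℤ)) 1 1 * y) = χ γ + φ x y)
    (hone : ∀ w : ℤ, φ 1 w = 0) (h01 : φ 0 1 = 0) (g : SL(2, ℤ)) (hdiff : IsCoprime (g 1 0 - g 1 1) (N : ℤ)) :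
    φ (g 0 0) (g 1 0) = φ (g 0 1) (g 1 1) := by
  obtain ⟨g', h00, h01', h10, h11⟩ := exists_sl2_entries (g 0 1) (-(g 0 0)) (g 1 1) (-(g 1 0))
    (by linear_combination det_entries g)
  have h := phi_col_eq_of_isCoprime_sum hsmall hφ hone h01 g' (by rw [h10, h11]; convert hdiff using 1; ring)
  rw [h00, h01', h10, h11, phi_neg hsmall hφ (isCoprime_apply g)] at h
  exact h.symm

/-- **Mixed rows, one labelled case**: `N = ℓ₁ ℓ₂ ℓ₃` (distinct primes, `ℓ₃` odd), `ℓ₁ ∣ d`, `ℓ₂ ∣ c`: then `c + d` or `c − d` is prime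
to `N`, so `φ(col₀ g) = φ(col₁ g)`. [cite: Manin1972, §1.7] -/
theorem phi_col_eq_of_dvd_of_dvd {ℓ₁ ℓ₂ ℓ₃ : ℕ} (h₁ : ℓ₁.Prime) (h₂ : ℓ₂.Prime) (h₃ : ℓ₃.Prime) (h₃2 : ℓ₃ ≠ 2)
    (hN : (N : ℤ) = ℓ₁ * ℓ₂ * ℓ₃)
    (hsmall : ∀ γ : Gamma0 N, ((γ : SL(2, ℤ)) 0 0 + (γ : SL(2, ℤ)) 1 1).natAbs ≤ 2 → χ γ = 0)
    (hφ : ∀ (γ : Gamma0 N) (x y : ℤ), IsCoprime x y →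
      φ ((γ : SL(2, ℤ)) 0 0 * x + (γ : SL(2, ℤ)) 0 1 * y) ((γ : SL(2, ℤ)) 1 0 * x + (γ : SL(2, ℤ)) 1 1 * y) = χ γ + φ x y)
    (hone : ∀ w : ℤ, φ 1 w = 0) (h01 : φ 0 1 = 0) (g : SL(2, ℤ))
    (hd : (ℓ₁ : ℤ) ∣ g 1 1) (hc : (ℓ₂ : ℤ) ∣ g 1 0) : φ (g 0 0) (g 1 0) = φ (g 0 1) (g 1 1) := by
  have hcd : IsCoprime (g 1 0) (g 1 1) := ⟨-(g 0 1), g 0 0, by linear_combination det_entries g⟩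
  have P1 := (Nat.prime_iff_prime_int.mp h₁)
  have P2 := (Nat.prime_iff_prime_int.mp h₂)
  have P3 := (Nat.prime_iff_prime_int.mp h₃)
  -- `ℓ₁ ∤ c`, `ℓ₂ ∤ d`
  have h1c : ¬ (ℓ₁ : ℤ) ∣ g 1 0 := fun h ↦ P1.not_unit (hcd.isUnit_of_dvd' h hd)
  have h2d : ¬ (ℓ₂ : ℤ) ∣ g 1 1 := fun h ↦ P2.not_unit (hcd.isUnit_of_dvd' hc h)
  -- coprimality to `N` from the three primes
  have cop : ∀ z : ℤ, ¬ (ℓ₁ : ℤ) ∣ z → ¬ (ℓ₂ : ℤ) ∣ z → ¬ (ℓ₃ : ℤ) ∣ z → IsCoprime z (N : ℤ) := by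
    intro z a b c
    rw [hN]
    exact (((Irreducible.coprime_iff_not_dvd P1.irreducible).mpr a).symm.mul_right
      ((Irreducible.coprime_iff_not_dvd P2.irreducible).mpr b).symm).mul_right
      ((Irreducible.coprime_iff_not_dvd P3.irreducible).mpr c).symm
  have s1 : ¬ (ℓ₁ : ℤ) ∣ g 1 0 + g 1 1 := fun h ↦ h1c (by simpa using dvd_sub h hd)
  have s2 : ¬ (ℓ₂ : ℤ) ∣ g 1 0 + g 1 1 := fun h ↦ h2d (by simpa using dvd_sub h hc)
  have d1 : ¬ (ℓ₁ : ℤ) ∣ g 1 0 - g 1 1 := fun h ↦ h1c (by simpa using dvd_add h hd)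
  have d2 : ¬ (ℓ₂ : ℤ) ∣ g 1 0 - g 1 1 := fun h ↦ h2d (by
    have := dvd_sub hc h; simpa using this)
  by_cases h3 : (ℓ₃ : ℤ) ∣ g 1 0 + g 1 1
  · -- then `ℓ₃ ∤ c − d` (else `ℓ₃ ∣ 2c`, `ℓ₃ ∣ 2d`)
    have d3 : ¬ (ℓ₃ : ℤ) ∣ g 1 0 - g 1 1 := by
      intro h
      have h2c : (ℓ₃ : ℤ) ∣ 2 * g 1 0 := by have := dvd_add h3 h; rwa [show g 1 0 + g 1 1 + (g 1 0 - g 1 1) = 2 * g 1 0 by ring] at this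
      have h2d' : (ℓ₃ : ℤ) ∣ 2 * g 1 1 := by have := dvd_sub h3 h; rwa [show g 1 0 + g 1 1 - (g 1 0 - g 1 1) = 2 * g 1 1 by ring] at this
      have n2 : ¬ (ℓ₃ : ℤ) ∣ 2 := fun h2 ↦ h₃2 ((Nat.prime_dvd_prime_iff_eq h₃ Nat.prime_two).mp (by exact_mod_cast h2))
      have hc3 : (ℓ₃ : ℤ) ∣ g 1 0 := (P3.dvd_or_dvd h2c).resolve_left n2
      have hd3 : (ℓ₃ : ℤ) ∣ g 1 1 := (P3.dvd_or_dvd h2d').resolve_left n2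
      exact P3.not_unit (hcd.isUnit_of_dvd' hc3 hd3)
    exact phi_col_eq_of_isCoprime_diff hsmall hφ hone h01 g (cop _ d1 d2 d3)
  · refine phi_col_eq_of_isCoprime_sum hsmall hφ hone h01 g ?_
    have e : -(g 1 0) - g 1 1 = -(g 1 0 + g 1 1) := by ring
    rw [e, IsCoprime.neg_left_iff]
    exact cop _ s1 s2 h3

/-- **The symbol function vanishes at `N = pqr`** given `φ(1, ·) ≡ 0` and `φ(0,1) = 0`. [cite: Manin1972, §1.7] -/
theorem phi_col_eq_threePrimes {p q r : ℕ} (hp : p.Prime) (hq : q.Prime) (hr : r.Prime)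
    (hp2 : p ≠ 2) (hq2 : q ≠ 2) (hr2 : r ≠ 2) (hN : N = p * q * r)
    (hsmall : ∀ γ : Gamma0 N, ((γ : SL(2, ℤ)) 0 0 + (γ : SL(2, ℤ)) 1 1).natAbs ≤ 2 → χ γ = 0)
    (hφ : ∀ (γ : Gamma0 N) (x y : ℤ), IsCoprime x y →
      φ ((γ : SL(2, ℤ)) 0 0 * x + (γ : SL(2, ℤ)) 0 1 * y) ((γ : SL(2, ℤ)) 1 0 * x + (γ : SL(2, ℤ)) 1 1 * y) = χ γ + φ x y)
    (hone : ∀ w : ℤ, φ 1 w = 0) (h01 : φ 0 1 = 0) (g : SL(2, ℤ)) :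
    φ (g 0 0) (g 1 0) = φ (g 0 1) (g 1 1) := by
  have Pp := Nat.prime_iff_prime_int.mp hp
  have Pq := Nat.prime_iff_prime_int.mp hq
  have Pr := Nat.prime_iff_prime_int.mp hr
  have cop : ∀ z : ℤ, ¬ (p : ℤ) ∣ z → ¬ (q : ℤ) ∣ z → ¬ (r : ℤ) ∣ z → IsCoprime z (N : ℤ) := by
    intro z a b c
    rw [hN]; push_cast
    exact (((Irreducible.coprime_iff_not_dvd Pp.irreducible).mpr a).symm.mul_right
      ((Irreducible.coprime_iff_not_dvd Pq.irreducible).mpr b).symm).mul_right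
      ((Irreducible.coprime_iff_not_dvd Pr.irreducible).mpr c).symm
  have hNz : ∀ {a b c : ℕ}, N = a * b * c → (N : ℤ) = a * b * c := by intro a b c h; rw [h]; push_cast; ring
  by_cases hdu : ¬ (p : ℤ) ∣ g 1 1 ∧ ¬ (q : ℤ) ∣ g 1 1 ∧ ¬ (r : ℤ) ∣ g 1 1
  · exact phi_col_eq_of_isCoprime_right hφ hone h01 g (cop _ hdu.1 hdu.2.1 hdu.2.2)
  by_cases hcu : ¬ (p : ℤ) ∣ g 1 0 ∧ ¬ (q : ℤ) ∣ g 1 0 ∧ ¬ (r : ℤ) ∣ g 1 0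
  · exact phi_col_eq_of_isCoprime_left hsmall hφ hone h01 g (cop _ hcu.1 hcu.2.1 hcu.2.2)
  have hcd : IsCoprime (g 1 0) (g 1 1) := ⟨-(g 0 1), g 0 0, by linear_combination det_entries g⟩
  -- some prime divides `d`, some prime divides `c`
  have hd' : (p : ℤ) ∣ g 1 1 ∨ (q : ℤ) ∣ g 1 1 ∨ (r : ℤ) ∣ g 1 1 := by
    by_contra h; push Not at h; exact hdu h
  have hc' : (p : ℤ) ∣ g 1 0 ∨ (q : ℤ) ∣ g 1 0 ∨ (r : ℤ) ∣ g 1 0 := by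
    by_contra h; push Not at h; exact hcu h
  have same : ∀ {ℓ : ℕ}, ℓ.Prime → (ℓ : ℤ) ∣ g 1 1 → (ℓ : ℤ) ∣ g 1 0 → φ (g 0 0) (g 1 0) = φ (g 0 1) (g 1 1) :=
    fun hℓ a b ↦ ((Nat.prime_iff_prime_int.mp hℓ).not_unit (hcd.isUnit_of_dvd' b a)).elim
  rcases hd' with hd | hd | hd <;> rcases hc' with hc | hc | hc
  · exact same hp hd hc
  · exact phi_col_eq_of_dvd_of_dvd hp hq hr hr2 (hNz hN) hsmall hφ hone h01 g hd hc
  · exact phi_col_eq_of_dvd_of_dvd hp hr hq hq2 (hNz (by rw [hN]; ring)) hsmall hφ hone h01 g hd hc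
  · exact phi_col_eq_of_dvd_of_dvd hq hp hr hr2 (hNz (by rw [hN]; ring)) hsmall hφ hone h01 g hd hc
  · exact same hq hd hc
  · exact phi_col_eq_of_dvd_of_dvd hq hr hp hp2 (hNz (by rw [hN]; ring)) hsmall hφ hone h01 g hd hc
  · exact phi_col_eq_of_dvd_of_dvd hr hp hq hq2 (hNz (by rw [hN]; ring)) hsmall hφ hone h01 g hd hc
  · exact phi_col_eq_of_dvd_of_dvd hr hq hp hp2 (hNz (by rw [hN]; ring)) hsmall hφ hone h01 g hd hc
  · exact same hr hd hc

/-! ## §2. The reduction at `N = pqr` -/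

/-- **(G‴)_N at `N = pqr` from the single-prime types.** For distinct odd primes `p, q, r`, `N = pqr`, an additive `χ : Γ₀(N) → 𝔽₂`
killing the trace-`±2` elements and `B₁` vanishes identically PROVIDED every normalised potential of `χ` vanishes at the cusps `1/w`
with exactly one of `p, q, r` dividing `w` (the certificate obligation; the other types are uniform). [cite: Manin1972, Thm. 1.9] -/
theorem chi_eq_zero_threePrimes_of_singleTypes {p q r : ℕ} [NeZero N] (hp : p.Prime) (hq : q.Prime) (hr : r.Prime)
    (hpq : p ≠ q) (hpr : p ≠ r) (hqr : q ≠ r) (hp2 : p ≠ 2) (hq2 : q ≠ 2) (hr2 : r ≠ 2) (hN : N = p * q * r)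
    (hadd : ∀ γ δ : Gamma0 N, χ (γ * δ) = χ γ + χ δ)
    (hsmall : ∀ γ : Gamma0 N, ((γ : SL(2, ℤ)) 0 0 + (γ : SL(2, ℤ)) 1 1).natAbs ≤ 2 → χ γ = 0)
    (hB1 : ∀ β : Gamma0 N, (β : SL(2, ℤ)) 0 1 = -1 → χ β = 0)
    (hcert : ∀ φ : ℤ → ℤ → ZMod 2,
      (∀ (γ : Gamma0 N) (x y : ℤ), IsCoprime x y →
        φ ((γ : SL(2, ℤ)) 0 0 * x + (γ : SL(2, ℤ)) 0 1 * y) ((γ : SL(2, ℤ)) 1 0 * x + (γ : SL(2, ℤ)) 1 1 * y) = χ γ + φ x y) →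
      φ 0 1 = 0 → (∀ d : ℕ, d ∣ N → φ 1 d = 0) →
      ∀ w : ℤ, (((p : ℤ) ∣ w ∧ ¬ (q : ℤ) ∣ w ∧ ¬ (r : ℤ) ∣ w) ∨ (¬ (p : ℤ) ∣ w ∧ (q : ℤ) ∣ w ∧ ¬ (r : ℤ) ∣ w) ∨
        (¬ (p : ℤ) ∣ w ∧ ¬ (q : ℤ) ∣ w ∧ (r : ℤ) ∣ w)) → φ 1 w = 0) :
    ∀ γ : Gamma0 N, χ γ = 0 := by
  have Pp := Nat.prime_iff_prime_int.mp hp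
  have Pq := Nat.prime_iff_prime_int.mp hq
  have Pr := Nat.prime_iff_prime_int.mp hr
  have cpq : Nat.Coprime p q := (Nat.coprime_primes hp hq).mpr hpq
  have cpr : Nat.Coprime p r := (Nat.coprime_primes hp hr).mpr hpr
  have cqr : Nat.Coprime q r := (Nat.coprime_primes hq hr).mpr hqr
  have hsq : Squarefree N := by
    rw [hN, Nat.squarefree_mul (Nat.Coprime.mul_left cpr cqr), Nat.squarefree_mul cpq]
    exact ⟨⟨hp.squarefree, hq.squarefree⟩, hr.squarefree⟩
  obtain ⟨φ, hφ, h01, h10, hbase⟩ := exists_potential_squarefree (χ := χ) hsq hadd hsmall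
  have cop : ∀ z : ℤ, ¬ (p : ℤ) ∣ z → ¬ (q : ℤ) ∣ z → ¬ (r : ℤ) ∣ z → IsCoprime z (N : ℤ) := by
    intro z a b c
    rw [hN]; push_cast
    exact (((Irreducible.coprime_iff_not_dvd Pp.irreducible).mpr a).symm.mul_right
      ((Irreducible.coprime_iff_not_dvd Pq.irreducible).mpr b).symm).mul_right
      ((Irreducible.coprime_iff_not_dvd Pr.irreducible).mpr c).symm
  -- two-prime types: prime colevel
  have two : ∀ {a b c : ℕ} {w : ℤ}, a.Prime → b.Prime → c.Prime → Nat.Coprime a c → Nat.Coprime b c → N = a * b * c →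
      (a : ℤ) ∣ w → (b : ℤ) ∣ w → ¬ (c : ℤ) ∣ w → φ 1 w = 0 := by
    intro a b c w ha hb hc cac cbc hNabc haw hbw hcw
    have hab : (((a * b : ℕ) : ℤ)) ∣ w := by
      push_cast
      by_cases hab' : a = b
      · subst hab'
        -- `a = b` cannot happen for a squarefree level, but the divisibility is not needed: use squarefreeness
        exfalso
        have : a * a ∣ N := ⟨c, by rw [hNabc]⟩
        exact ha.one_lt.ne' (Nat.isUnit_iff.mp (hsq a this))
      · exact (Nat.isCoprime_iff_coprime.mpr ((Nat.coprime_primes ha hb).mpr hab')).mul_dvd haw hbw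
    exact phi_one_eq_zero_of_dvd_of_coprime_prime (d := a * b) (M := c) (by rw [hNabc]) hc
      (Nat.Coprime.mul_left cac cbc) hsmall hφ hB1 (hbase (a * b) ⟨c, by rw [hNabc]⟩) hab hcw
  have hone : ∀ w : ℤ, φ 1 w = 0 := by
    intro w
    by_cases ha : (p : ℤ) ∣ w <;> by_cases hb : (q : ℤ) ∣ w <;> by_cases hc : (r : ℤ) ∣ w
    · -- all three: `N ∣ w`
      have hNw : (N : ℤ) ∣ w := by
        rw [hN]; push_cast
        exact (Nat.isCoprime_iff_coprime.mpr (Nat.Coprime.mul_left cpr cqr)).mul_dvd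
          ((Nat.isCoprime_iff_coprime.mpr cpq).mul_dvd ha hb) hc
      rw [phi_one_eq_of_dvd hsmall hφ hNw, h10]
    · exact two hp hq hr cpr cqr hN ha hb hc
    · exact two hp hr hq cpq cqr.symm (by rw [hN]; ring) ha hc hb
    · exact hcert φ hφ h01 hbase w (Or.inl ⟨ha, hb, hc⟩)
    · exact two hq hr hp cpq.symm cpr.symm (by rw [hN]; ring) hb hc ha
    · exact hcert φ hφ h01 hbase w (Or.inr (Or.inl ⟨ha, hb, hc⟩))
    · exact hcert φ hφ h01 hbase w (Or.inr (Or.inr ⟨ha, hb, hc⟩))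
    · rw [phi_one_eq_of_isCoprime hadd hφ hB1 (cop w ha hb hc), h01]
  exact chi_eq_zero_of_phi_col_eq hsmall hφ (phi_col_eq_threePrimes hp hq hr hp2 hq2 hr2 hN hsmall hφ hone h01)

/-- **The node at `N = pqr` from the single-type certificate obligation** (rtt-p3-w4 g2's `cuspSpanEvenAtTwo_of_forall_b1_odd` ∘ the
previous theorem). BSD is not proved by this. [cite: Pollack2003, Conj. 6.3] [cite: Manin1972, Thm. 1.9] -/
theorem cuspSpanEvenAtTwo_threePrimes_of_singleTypes {p q r : ℕ} [NeZero N] (hp : p.Prime) (hq : q.Prime) (hr : r.Prime)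
    (hpq : p ≠ q) (hpr : p ≠ r) (hqr : q ≠ r) (hp2 : p ≠ 2) (hq2 : q ≠ 2) (hr2 : r ≠ 2) (hN : N = p * q * r)
    (hcert : ∀ (χ : Gamma0 N → ZMod 2) (φ : ℤ → ℤ → ZMod 2),
      (∀ γ δ : Gamma0 N, χ (γ * δ) = χ γ + χ δ) →
      (∀ γ : Gamma0 N, ((γ : SL(2, ℤ)) 0 0 + (γ : SL(2, ℤ)) 1 1).natAbs ≤ 2 → χ γ = 0) →
      (∀ γ : Gamma0 N, (∃ k : ℕ, 1 ≤ k ∧ ((γ : SL(2, ℤ)) 1 1).natAbs = 4 ^ k) → χ γ = 0) →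
      (∀ β : Gamma0 N, (β : SL(2, ℤ)) 0 1 = -1 → χ β = 0) →
      (∀ (γ : Gamma0 N) (x y : ℤ), IsCoprime x y →
        φ ((γ : SL(2, ℤ)) 0 0 * x + (γ : SL(2, ℤ)) 0 1 * y) ((γ : SL(2, ℤ)) 1 0 * x + (γ : SL(2, ℤ)) 1 1 * y) = χ γ + φ x y) →
      φ 0 1 = 0 → (∀ d : ℕ, d ∣ N → φ 1 d = 0) →
      ∀ w : ℤ, (((p : ℤ) ∣ w ∧ ¬ (q : ℤ) ∣ w ∧ ¬ (r : ℤ) ∣ w) ∨ (¬ (p : ℤ) ∣ w ∧ (q : ℤ) ∣ w ∧ ¬ (r : ℤ) ∣ w) ∨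
        (¬ (p : ℤ) ∣ w ∧ ¬ (q : ℤ) ∣ w ∧ (r : ℤ) ∣ w)) → φ 1 w = 0) :
    CuspSpanEvenAtTwo N := by
  have hNodd : Odd N := by
    rw [hN]; exact ((hp.odd_of_ne_two hp2).mul (hq.odd_of_ne_two hq2)).mul (hr.odd_of_ne_two hr2)
  exact cuspSpanEvenAtTwo_of_forall_b1_odd hNodd fun χ' hadd hsmall hkill hB1 ↦
    chi_eq_zero_threePrimes_of_singleTypes hp hq hr hpq hpr hqr hp2 hq2 hr2 hN hadd hsmall hB1
      (fun φ hφ h01 hbase ↦ hcert χ' φ hadd hsmall hkill hB1 hφ h01 hbase)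

end Potential

end Summit.BirchSwinnertonDyer.BirchSwinnertonDyer.Theorems.SignedMuAtTwo

end
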